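import Literature.Geometry.Riemannian.PerelmanNoncollapsingInterior
import Literature.Geometry.Lorentzian.MetricComparison
import HarnessLib

/-!
# Uniform comparison of metrics, gradients and volumes along a Ricci flow on `[0, T']`
# (Topping 2006, Lemma 5.3.2 and (2.5.7))

For a Ricci flow `(g, cov)` of Riemannian metrics on the compact time interval `[0, T']`
(`T' > 0`) on a closed manifold modelled on `ℝᵐ` (`IsRicciFlow g cov (Icc 0 T')`), every
geometric quantity entering a Sobolev / Nash inequality is comparable, UNIFORMLY in
`t ∈ [0, T']`, to the same quantity of the initial metric `g(0)`:

* `IsRicciFlow.exists_val_le_mul_val_Icc` — **metrics**: there is `L ≥ 1` with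
  `g_t(X, X) ≤ L g_0(X, X)` and `g_0(X, X) ≤ L g_t(X, X)` for all `t ∈ [0, T']` and all tangent
  vectors `X`. The curvature of the flow is bounded on `M × [0, T']`
  (`IsContMDiffFamilyOn.exists_curvatureBoundedBy_of_isCompact`, compactness), hence
  `|Ric_t(X, X)| ≤ K₁ g_t(X, X)` (`CurvatureBoundedBy.abs_ricci_le`) and Topping's Lemma 5.3.2
  (`IsRicciFlow.metric_equivalence`) gives `e^{−2K₁t} g_0 ≤ g_t ≤ e^{2K₁t} g_0`; take
  `L = e^{2K₁T'}`;
* `IsRicciFlow.exists_gradSq_le_mul_gradSq_Icc` — **gradients**: with the same `L`,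
  `|∇w|²_{g(t)} ≤ L |∇w|²_{g(0)}` and `|∇w|²_{g(0)} ≤ L |∇w|²_{g(t)}` pointwise for every function
  `w` (comparable metrics have comparable inverse metrics,
  `PseudoRiemannianMetric.innerDual_le_mul_innerDual_of_val_le`, and
  `|∇w|²_g = g⁻¹(dw, dw)` is `PseudoRiemannianMetric.gradSq`);
* `IsRicciFlow.exists_riemVolume_le_smul_Icc` — **volume measures**: there is `C ≥ 1` with
  `dV_{g(t)} ≤ C dV_{g(0)}` and `dV_{g(0)} ≤ C dV_{g(t)}` as measures for all `t ∈ [0, T']`: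
  `dV_t = e^{−∫ₛᵗ R} dV_s` (Topping (2.5.7), `IsRicciFlow.riemVolume_eq_withDensity`) and
  `|R| ≤ K` on `M × [0, T']` (`IsRicciFlow.continuousOn_scalarCurvatureWith_prod` and
  compactness), so the density is at most `e^{K T'}`;
* `IsRicciFlow.exists_integral_le_mul_integral_Icc` — the same comparison for the integrals of
  nonnegative integrable functions, `∫ f dV_t ≤ C ∫ f dV_0` and `∫ f dV_0 ≤ C ∫ f dV_t`.

These are the ingredients that make the constants of the Nash / Sobolev inequality of `g(t)`
uniform in `t ∈ [0, T']` (the Nash inequality of the single metric `g(0)` is elsewhere; this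
file does not mention it). Everything is proved; no definitions, no named facts.

## References

* P. Topping, *Lectures on the Ricci flow*, LMS Lecture Note Series 325, Cambridge Univ. Press
  2006, Lemma 5.3.2 (p. 47), (2.5.7) (p. 33), §5.3 (proof of Thm. 5.3.1, p. 46). [Topping2006]
-/

noncomputable section

open Bundle Set Function Filter Manifold MeasureTheory Measure TopologicalSpace Module
open scoped Manifold ContDiff Topology ENNReal NNReal

namespace Literature.Geometry.Riemannian

open Lorentzian Lorentzian.PseudoRiemannianMetric

section UniformComparison

variable {m : ℕ} {H : Type*} [TopologicalSpace H]
  {I : ModelWithCorners ℝ (EuclideanSpace ℝ (Fin m)) H} [I.Boundaryless]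
  {M : Type*} [TopologicalSpace M] [ChartedSpace H M] [IsManifold I ∞ M]
  [T2Space M] [CompactSpace M] [MeasurableSpace M] [BorelSpace M]
  {g : ℝ → PseudoRiemannianMetric I ∞ (EuclideanSpace ℝ (Fin m)) (TangentSpace I : M → Type _)}
  {cov : ℝ → CovariantDerivative I (EuclideanSpace ℝ (Fin m)) (TangentSpace I : M → Type _)}

/-! ### Metrics -/

omit [I.Boundaryless] [MeasurableSpace M] [BorelSpace M] in
/-- **Uniform equivalence of the metrics along a Ricci flow on a compact time interval**
(Topping 2006, Lemma 5.3.2, with the curvature bound supplied by compactness of `M × [0, T']`):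
for a Ricci flow of Riemannian metrics on `[0, T']`, `T' > 0`, on a closed manifold modelled on
`ℝᵐ` there is `L ≥ 1` with `g_t(X, X) ≤ L · g_0(X, X)` and `g_0(X, X) ≤ L · g_t(X, X)` for all
`t ∈ [0, T']`, `x ∈ M`, `X ∈ T_x M`. Proof: `|Rm| ≤ K` on `M × [0, T']`
(`exists_curvatureBoundedBy_of_isCompact`), so `|Ric_t(X, X)| ≤ m K g_t(X, X)`
(`CurvatureBoundedBy.abs_ricci_le`) and `e^{−2mKt} g_0 ≤ g_t ≤ e^{2mKt} g_0`
(`IsRicciFlow.metric_equivalence`); `L = e^{2mKT'}`. [cite: Topping2006, Lemma 5.3.2] -/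
theorem IsRicciFlow.exists_val_le_mul_val_Icc {T' : ℝ} (hT' : 0 < T')
    (hflow : IsRicciFlow g cov (Icc 0 T')) (hR : ∀ t ∈ Icc 0 T', (g t).IsRiemannian) :
    ∃ L : ℝ, 1 ≤ L ∧ ∀ t ∈ Icc 0 T', ∀ (x : M) (X : TangentSpace I x),
      (g t).val x X X ≤ L * (g 0).val x X X ∧ (g 0).val x X X ≤ L * (g t).val x X X := by
  have h0 : (0 : ℝ) ∈ Icc 0 T' := ⟨le_rfl, hT'.le⟩
  -- curvature bound on `M × [0, T']` and the Ricci bound it implies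
  obtain ⟨K₀, hK₀⟩ := hflow.smooth.exists_curvatureBoundedBy_of_isCompact hflow.isLeviCivita
    isCompact_Icc subset_rfl hR
  set K : ℝ := max K₀ 0 with hKdef
  have hK0 : 0 ≤ K := le_max_right _ _
  have hK : ∀ t ∈ Icc 0 T', CurvatureBoundedBy (g t) (cov t) K := fun t ht ↦
    (hK₀ t ht).mono (le_max_left _ _)
  have hRic : ∀ t ∈ Icc 0 T', ∀ (x : M) (X : TangentSpace I x),
      |(cov t).ricci x X X| ≤ (finrank ℝ (EuclideanSpace ℝ (Fin m)) * K) * (g t).val x X X :=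
    fun t ht x X ↦ (hK t ht).abs_ricci_le (hR t ht) x X
  set K₁ : ℝ := finrank ℝ (EuclideanSpace ℝ (Fin m)) * K with hK₁def
  have hK₁ : 0 ≤ K₁ := by positivity
  refine ⟨Real.exp (2 * K₁ * T'), Real.one_le_exp (by positivity), fun t ht x X ↦ ?_⟩
  have h := hflow.metric_equivalence hR hRic t ht x X
  have hexp : Real.exp (2 * K₁ * t) ≤ Real.exp (2 * K₁ * T') :=
    Real.exp_le_exp.2 (mul_le_mul_of_nonneg_left ht.2 (by positivity))
  -- `g_s(X, X) ≥ 0` at the two times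
  have hnn : ∀ s ∈ Icc 0 T', 0 ≤ (g s).val x X X := fun s hs ↦ by
    by_cases hX : X = 0
    · simp [hX]
    · exact (hR s hs x X hX).le
  refine ⟨h.2.trans (mul_le_mul_of_nonneg_right hexp (hnn 0 h0)), ?_⟩
  -- lower bound `e^{-2K₁t} g_0 ≤ g_t`, i.e. `g_0 ≤ e^{2K₁t} g_t ≤ e^{2K₁T'} g_t`
  have h1 : (g 0).val x X X ≤ Real.exp (2 * K₁ * t) * (g t).val x X X := by
    have h' := h.1
    rwa [Real.exp_neg, inv_mul_le_iff₀ (Real.exp_pos _)] at h'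
  exact h1.trans (mul_le_mul_of_nonneg_right hexp (hnn t ht))

/-! ### Gradients -/

omit [I.Boundaryless] [MeasurableSpace M] [BorelSpace M] in
/-- **Uniform equivalence of the gradient squares along a Ricci flow on a compact time
interval**: for a Ricci flow of Riemannian metrics on `[0, T']`, `T' > 0`, on a closed manifold
modelled on `ℝᵐ` there is `L ≥ 1` with `|∇w|²_{g(t)}(x) ≤ L |∇w|²_{g(0)}(x)` and
`|∇w|²_{g(0)}(x) ≤ L |∇w|²_{g(t)}(x)` for all `t ∈ [0, T']`, all functions `w : M → ℝ` and all
`x` (`|∇w|²_g = g⁻¹(dw, dw)`, `PseudoRiemannianMetric.gradSq`). The metrics are uniformly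
equivalent (`exists_val_le_mul_val_Icc`, Topping 2006, Lemma 5.3.2) and comparable Riemannian
metrics have comparable inverse metrics on covectors
(`PseudoRiemannianMetric.innerDual_le_mul_innerDual_of_val_le`).
[cite: Topping2006, Lemma 5.3.2] -/
theorem IsRicciFlow.exists_gradSq_le_mul_gradSq_Icc {T' : ℝ} (hT' : 0 < T')
    (hflow : IsRicciFlow g cov (Icc 0 T')) (hR : ∀ t ∈ Icc 0 T', (g t).IsRiemannian) :
    ∃ L : ℝ, 1 ≤ L ∧ ∀ t ∈ Icc 0 T', ∀ (w : M → ℝ) (x : M),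
      (g t).gradSq w x ≤ L * (g 0).gradSq w x ∧ (g 0).gradSq w x ≤ L * (g t).gradSq w x := by
  obtain ⟨L, hL1, hL⟩ := hflow.exists_val_le_mul_val_Icc hT' hR
  have h0 : (0 : ℝ) ∈ Icc 0 T' := ⟨le_rfl, hT'.le⟩
  have hL0 : 0 ≤ L := zero_le_one.trans hL1
  refine ⟨L, hL1, fun t ht w x ↦ ⟨?_, ?_⟩⟩
  · exact innerDual_le_mul_innerDual_of_val_le (hR t ht) (hR 0 h0) hL0 x
      (fun v ↦ (hL t ht x v).2) _
  · exact innerDual_le_mul_innerDual_of_val_le (hR 0 h0) (hR t ht) hL0 x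
      (fun v ↦ (hL t ht x v).1) _

/-! ### Volume measures -/

omit [T2Space M] [MeasurableSpace M] [BorelSpace M] in
/-- The densities `e^{−∫ₛᵗ R(p, τ) dτ}` relating the volume measures of a Ricci flow on `[0, T']`
(Topping 2006, (2.5.7)) are bounded by `e^{K T'}` uniformly in `s, t ∈ [0, T']` and `p ∈ M`,
`K ≥ 0` a bound for `|R|` on the compact set `M × [0, T']` (`R` is jointly continuous,
`IsRicciFlow.continuousOn_scalarCurvatureWith_prod`). [cite: Topping2006, (2.5.7) (p. 33)] -/
theorem IsRicciFlow.exists_exp_neg_integral_scalarCurvature_le {T' : ℝ} (hT' : 0 < T')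
    (hflow : IsRicciFlow g cov (Icc 0 T')) :
    ∃ K : ℝ, 0 ≤ K ∧ ∀ s ∈ Icc 0 T', ∀ t ∈ Icc 0 T', ∀ p : M,
      Real.exp (-∫ τ in s..t, (g τ).scalarCurvatureWith (cov τ) p) ≤ Real.exp (K * T') := by
  have hRc : ContinuousOn (fun p : M × ℝ ↦ (g p.2).scalarCurvatureWith (cov p.2) p.1)
      (univ ×ˢ Icc 0 T') := hflow.continuousOn_scalarCurvatureWith_prod (uniqueDiffOn_Icc hT')
  obtain ⟨K₀, hK₀⟩ := (isCompact_univ.prod isCompact_Icc).exists_bound_of_continuousOn hRc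
  refine ⟨max K₀ 0, le_max_right _ _, fun s hs t ht p ↦ Real.exp_le_exp.2 ?_⟩
  -- `|∫ₛᵗ R(p, τ) dτ| ≤ K |t - s| ≤ K T'`
  have hint : ‖∫ τ in s..t, (g τ).scalarCurvatureWith (cov τ) p‖ ≤ max K₀ 0 * |t - s| := by
    refine intervalIntegral.norm_integral_le_of_norm_le_const fun τ hτ ↦ ?_
    exact (hK₀ (p, τ) ⟨mem_univ _, uIcc_subset_Icc hs ht (uIoc_subset_uIcc hτ)⟩).trans
      (le_max_left _ _)
  have hts : |t - s| ≤ T' := by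
    rw [abs_sub_le_iff]
    constructor <;> linarith [hs.1, hs.2, ht.1, ht.2]
  calc -∫ τ in s..t, (g τ).scalarCurvatureWith (cov τ) p
      ≤ ‖∫ τ in s..t, (g τ).scalarCurvatureWith (cov τ) p‖ := by
        rw [Real.norm_eq_abs]; exact neg_le_abs _
    _ ≤ max K₀ 0 * |t - s| := hint
    _ ≤ max K₀ 0 * T' := mul_le_mul_of_nonneg_left hts (le_max_right _ _)

/-- **Uniform equivalence of the volume measures along a Ricci flow on a compact time interval**
(Topping 2006, (2.5.7) `∂ₜ dV = −R dV`, integrated, with `|R| ≤ K` on `M × [0, T']`): for a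
Ricci flow of Riemannian metrics on `[0, T']`, `T' > 0`, on a closed manifold modelled on `ℝᵐ`
there is `C ≥ 1` with `dV_{g(t)} ≤ C · dV_{g(0)}` and `dV_{g(0)} ≤ C · dV_{g(t)}` as measures for
every `t ∈ [0, T']`. Indeed `dV_t = e^{−∫ₛᵗ R} dV_s` (`IsRicciFlow.riemVolume_eq_withDensity`)
with density `≤ e^{K T'}` (`exists_exp_neg_integral_scalarCurvature_le`); `C = e^{K T'}`.
[cite: Topping2006, (2.5.7) (p. 33)] -/
theorem IsRicciFlow.exists_riemVolume_le_smul_Icc {T' : ℝ} (hT' : 0 < T')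
    (hflow : IsRicciFlow g cov (Icc 0 T')) (hR : ∀ t ∈ Icc 0 T', (g t).IsRiemannian) :
    ∃ C : ℝ≥0, 1 ≤ C ∧ ∀ t ∈ Icc 0 T',
      (g t).riemVolume ≤ C • (g 0).riemVolume ∧ (g 0).riemVolume ≤ C • (g t).riemVolume := by
  obtain ⟨K, hK0, hK⟩ := hflow.exists_exp_neg_integral_scalarCurvature_le hT'
  have h0 : (0 : ℝ) ∈ Icc 0 T' := ⟨le_rfl, hT'.le⟩
  -- `dV_t ≤ e^{K T'} dV_s` for all `s, t ∈ [0, T']`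
  have key : ∀ s ∈ Icc 0 T', ∀ t ∈ Icc 0 T',
      (g t).riemVolume ≤ (Real.exp (K * T')).toNNReal • (g s).riemVolume := by
    intro s hs t ht
    rw [hflow.riemVolume_eq_withDensity (convex_Icc 0 T') hR hs ht, ← coe_nnreal_smul,
      ← withDensity_const]
    exact withDensity_mono (Eventually.of_forall fun p ↦ ENNReal.ofReal_le_ofReal (hK s hs t ht p))
  refine ⟨(Real.exp (K * T')).toNNReal, ?_, fun t ht ↦ ⟨key 0 h0 t ht, key t ht 0 h0⟩⟩
  exact Real.one_le_toNNReal.2 (Real.one_le_exp (by positivity))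

/-- **Uniform comparison of integrals along a Ricci flow on a compact time interval**: for a
Ricci flow of Riemannian metrics on `[0, T']`, `T' > 0`, on a closed manifold modelled on `ℝᵐ`
there is `C ≥ 1` with `∫ f dV_{g(t)} ≤ C ∫ f dV_{g(0)}` and `∫ f dV_{g(0)} ≤ C ∫ f dV_{g(t)}` for
every `t ∈ [0, T']` and every nonnegative `f` integrable for both measures (monotonicity of the
integral in the measure, from `exists_riemVolume_le_smul_Icc`; Topping 2006, (2.5.7)).
[cite: Topping2006, (2.5.7) (p. 33)] -/
theorem IsRicciFlow.exists_integral_le_mul_integral_Icc {T' : ℝ} (hT' : 0 < T')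
    (hflow : IsRicciFlow g cov (Icc 0 T')) (hR : ∀ t ∈ Icc 0 T', (g t).IsRiemannian) :
    ∃ C : ℝ, 1 ≤ C ∧ ∀ t ∈ Icc 0 T', ∀ f : M → ℝ, (∀ x, 0 ≤ f x) → Integrable f (g 0).riemVolume →
      Integrable f (g t).riemVolume →
      ∫ x, f x ∂(g t).riemVolume ≤ C * ∫ x, f x ∂(g 0).riemVolume ∧
        ∫ x, f x ∂(g 0).riemVolume ≤ C * ∫ x, f x ∂(g t).riemVolume := by
  obtain ⟨C, hC1, hC⟩ := hflow.exists_riemVolume_le_smul_Icc hT' hR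
  refine ⟨(C : ℝ), by exact_mod_cast hC1, fun t ht f hf hf0 hft ↦ ⟨?_, ?_⟩⟩
  · calc ∫ x, f x ∂(g t).riemVolume ≤ ∫ x, f x ∂(C • (g 0).riemVolume) :=
          integral_mono_measure (hC t ht).1 (Eventually.of_forall hf) hf0.smul_measure_nnreal
      _ = C * ∫ x, f x ∂(g 0).riemVolume := by
          rw [integral_smul_nnreal_measure, NNReal.smul_def, smul_eq_mul]
  · calc ∫ x, f x ∂(g 0).riemVolume ≤ ∫ x, f x ∂(C • (g t).riemVolume) :=
          integral_mono_measure (hC t ht).2 (Eventually.of_forall hf) hft.smul_measure_nnreal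
      _ = C * ∫ x, f x ∂(g t).riemVolume := by
          rw [integral_smul_nnreal_measure, NNReal.smul_def, smul_eq_mul]

end UniformComparison

end Literature.Geometry.Riemannian

end
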